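import Mathlib.Probability.ProbabilityMassFunction.Constructions
import Mathlib.Probability.Distributions.Uniform
import Mathlib.Algebra.Group.Subgroup.Basic
import Literature.Computability.Cryptography.LWE
import Literature.Computability.Cryptography.LWEProofs
import HarnessLib

/-!
# Search ⇒ decision for LWE: analysis of the one-query zero-residual distinguisher

Sibling analysis file of `Literature.Computability.Cryptography.LWE` (trunk T-LATTICE), written for the
discharge of `Literature.Computability.Cryptography.regev_search_to_decision` (the easy direction of
Regev's search/decision equivalence; Regev 2009, §1, p. 4: "being able to distinguish [LWE samples]
from [uniform samples] is equivalent to solving LWE" — only the hard direction, Lemmas 4.1–4.2, is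
printed in §4, the easy one being folklore). Everything here is PROVED; no fact is vendored.

**The distinguisher.** Given a deterministic search solver `F` on `m` samples, the distinguisher on
`m + 1` samples `S = (x, t)` (`x = S 0` the fresh sample, `t = Fin.tail S` the rest) accepts iff the
residual of the fresh sample against the solver's guess vanishes: `x.2 = ⟨x.1, F t⟩`
(`zeroResidualTest`, `zeroResidualDistinguisher`).

**The analysis** (`χ` an arbitrary noise law on `ℤ_q`):

* on uniform samples the fresh sample is uniform and independent of `t`, so the acceptance
  probability is exactly `1/q` (`acceptProb_zeroResidual_uniformSamples`);
* on LWE samples with a uniform secret `s` (the same `s` in both blocks), conditionally on `s` and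
  `t` the test reads `e = ⟨a, F t - s⟩` with `a` uniform and `e ∼ χ`: the acceptance probability is
  `E_a χ(⟨a, c⟩)`, `c = F t - s` (`lweSample_map_residualTest_apply`). For `c = 0` this is `χ(0)`;
  in general `a ↦ ⟨a, c⟩` is a homomorphism onto a subgroup `H ≤ ℤ_q` pushing the uniform law to the
  uniform law on `H`, so it is `χ(H)/|H| ≥ 1/q` as soon as `χ(H) ≥ |H|/q` for all subgroups
  (`inv_le_tsum_uniform_mul_apply_dotProduct`; the subgroup bound is a hypothesis here and a
  theorem for Regev's `Ψ̄_α`, `discretizedGaussian_sum_addSubgroup_ge` of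
  `DiscretizedGaussianMass.lean`);
* hence `Pr_LWE[accept] ≥ (1/q)·Pr[F t ≠ s] + χ(0)·Pr[F t = s]`
  (`le_acceptProb_zeroResidual_lwe`) and the advantage is at least
  `(χ(0) - 1/q) · Pr[F solves]` (`distinguishingAdvantage_zeroResidual_ge`), where `Pr[F solves]` is
  exactly `searchSuccessProb χ m (pure ∘ F)` (`searchSuccessProb_pure_eq`).

## Tree search: two chains towards one discharge (state as of this file)

Attempt 0 of this unit is building a DIFFERENT design for the same discharge, the classical
`T`-block residual test, and keeps landing files; as this file is written its chain consists of
`LWESampling.lean`, `LWEGaussTheta.lean`, `LWEGaussMass.lean`, `LWENoiseGaussianZero.lean`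
(`discretizedGaussian_zero_ge`, the `hgauss` input), `LWESearchToDecisionTest.lean`
(`LWE.resCount`/`LWE.Accepts`, Chebyshev estimates) and `LWESearchToDecision.lean`
(`IsS2DQueryMap`, `IsS2DVerdict`, and the assembly `regev_search_to_decision_of_machine` modulo a
machine hypothesis `hmach` still to be supplied). The present ONE-QUERY chain is
`DiscretizedGaussianMass.lean` (both `Ψ̄_α(0) ≥ 1/q + (4/(3π)) sin(π/q) e^{-πα²}` and the subgroup
bound `Ψ̄_α(H) ≥ |H|/q`) → this file → `LWESearchToDecisionMachine.lean` (the oracle algorithm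
`S2D.s2dAlg` with `S2D.s2dAlg_isPolyTime`, `S2D.oracleLWEDistinguisher_s2dAlg`; one query, no
coins, no counting loop) → the assembly `regev_search_to_decision_holds` in `LWEHardnessProofs.lean`
(to come), and it imports nothing from the `T`-block chain. The two chains are independent:
whichever assembly lands first discharges the fact; the other chain then becomes retirable, which
a librarian should decide only after checking importers with `lean search` at that time (both
chains are still growing). Why a second design at all: the one-query test needs `m' = m + 1`
samples, no concentration inequality and a machine that is a projection plus one inner product,
whereas the `T`-block test needs `T ≈ k²q²` extra samples, Chebyshev, and a machine with a
counting loop and a threshold comparison. Overlap with `LWESearchToDecisionTest.lean`: its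
correct-guess law `toOuterMeasure_lweSample_zeroResidual` (`= χ(0)`) and uniform law
`toOuterMeasure_uniform_zeroResidual` (`= 1/q`), both for the SET `LWE.zeroResidual s'`, are the
special cases `s' = s` / uniform of `lweSample_map_residualTest_apply` and
`uniform_map_residualTest_apply` below; the general wrong-guess identity
`Pr[accept | s, s'] = E_a χ(⟨a, s' - s⟩)` for ARBITRARY `s'`, on which the subgroup argument rests,
is not in that file, and the `PMF.map`/`decide` form used here is the one the monadic block
decomposition (`map_zeroResidualTest_bind_cons_apply`) produces, so nothing is imported from it.

## References

* O. Regev, *On lattices, learning with errors, random linear codes, and cryptography*, J. ACM 56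
  (2009), art. 34, doi:10.1145/1568318.1568324, §1 (p. 4 of arXiv:2401.03703: search/decision
  equivalence), §2, §4 [RegevLWE2009].
* C. Peikert, *A decade of lattice cryptography*, Found. Trends TCS 10 (2016), §4.2.2 (decision-LWE,
  "the search-to-decision direction is trivial").
-/

noncomputable section

open scoped ENNReal

namespace Literature.Computability.Cryptography

namespace LWE

variable {n m q : ℕ}

/-! ### The test -/

section Test

/-- The **zero-residual test** of a deterministic search solver `F` on `m` samples, applied to
`m + 1` samples: feed the last `m` samples (`Fin.tail S`) to `F` and accept iff the residual of the
fresh first sample `S 0 = (a, b)` against the guess vanishes, `b = ⟨a, F (tail S)⟩`.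
[Regev 2009, §1 (search ⇒ decision); Peikert 2016, §4.2.2] [cite: RegevLWE2009, §1 p. 4] -/
def zeroResidualTest (F : (Fin m → (Fin n → ZMod q) × ZMod q) → (Fin n → ZMod q))
    (S : Fin (m + 1) → (Fin n → ZMod q) × ZMod q) : Bool :=
  decide ((S 0).2 = (S 0).1 ⬝ᵥ F (Fin.tail S))

/-- The deterministic distinguisher of the zero-residual test (a Dirac Markov kernel).
[Regev 2009, §1] [cite: RegevLWE2009, §1 p. 4] -/
def zeroResidualDistinguisher (F : (Fin m → (Fin n → ZMod q) × ZMod q) → (Fin n → ZMod q)) :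
    Distinguisher (Fin n) (ZMod q) (m + 1) :=
  fun S => PMF.pure (zeroResidualTest F S)

/-- The test on `Fin.cons x t` reads `x.2 = ⟨x.1, F t⟩`. [folklore] -/
@[simp] theorem zeroResidualTest_cons (F : (Fin m → (Fin n → ZMod q) × ZMod q) → (Fin n → ZMod q))
    (x : (Fin n → ZMod q) × ZMod q) (t : Fin m → (Fin n → ZMod q) × ZMod q) :
    zeroResidualTest F (Fin.cons x t) = decide (x.2 = x.1 ⬝ᵥ F t) := by
  simp [zeroResidualTest]

/-- `acceptProb` of a Dirac kernel is the mass of the accepted set. [folklore] -/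
theorem acceptProb_pure_comp {β : Type} (g : β → Bool) (P : PMF β) :
    acceptProb (fun b => PMF.pure (g b)) P = (P.map g) true := by
  rw [acceptProb, ← PMF.bind_pure_comp]
  rfl

/-- `acceptProb` of the zero-residual distinguisher is the mass of the accepted set. [folklore] -/
theorem acceptProb_zeroResidualDistinguisher
    (F : (Fin m → (Fin n → ZMod q) × ZMod q) → (Fin n → ZMod q))
    (P : PMF (Fin (m + 1) → (Fin n → ZMod q) × ZMod q)) :
    acceptProb (zeroResidualDistinguisher F) P = (P.map (zeroResidualTest F)) true :=
  acceptProb_pure_comp _ _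

/-- Mass of `true` under the push-forward by a decidable predicate. [folklore] -/
theorem map_decide_apply_true {β : Type} (P : PMF β) (C : β → Prop) [DecidablePred C] :
    (P.map fun b => decide (C b)) true = ∑' b, if C b then P b else 0 := by
  rw [PMF.map_apply]
  refine tsum_congr fun b => ?_
  by_cases h : C b <;> simp [h]

end Test

/-! ### Two-block decomposition -/

section Blocks

/-- **Fresh sample first**: for a law `P₁ ⊗ P₂` presented as `x ← P₁; t ← P₂; cons x t`, the
acceptance probability of the zero-residual test is `E_{t ∼ P₂} P₁{x | x.2 = ⟨x.1, F t⟩}`. [folklore] -/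
theorem map_zeroResidualTest_bind_cons_apply (F : (Fin m → (Fin n → ZMod q) × ZMod q) → (Fin n → ZMod q))
    (P₁ : PMF ((Fin n → ZMod q) × ZMod q)) (P₂ : PMF (Fin m → (Fin n → ZMod q) × ZMod q)) :
    ((P₁.bind fun x => P₂.map (Fin.cons x)).map (zeroResidualTest F)) true =
      ∑' t, P₂ t * (P₁.map fun x => decide (x.2 = x.1 ⬝ᵥ F t)) true := by
  rw [PMF.map_bind]
  have h : (P₁.bind fun x => (P₂.map (Fin.cons x)).map (zeroResidualTest F)) =
      P₂.bind fun t => P₁.map fun x => decide (x.2 = x.1 ⬝ᵥ F t) := by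
    simp_rw [PMF.map_comp, PMF.map, Function.comp_def, zeroResidualTest_cons]
    exact PMF.bind_comm _ _ _
  rw [h, PMF.bind_apply]

end Blocks

/-! ### The fresh sample: uniform versus LWE -/

section Fresh

variable [NeZero q]

/-- On a uniform fresh sample the test accepts with probability exactly `1/q`, whatever the guess.
[Regev 2009, §1] [folklore] -/
theorem uniform_map_residualTest_apply (c : Fin n → ZMod q) :
    ((PMF.uniformOfFintype ((Fin n → ZMod q) × ZMod q)).map fun x => decide (x.2 = x.1 ⬝ᵥ c)) true
      = (q : ℝ≥0∞)⁻¹ := by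
  classical
  rw [map_decide_apply_true, tsum_fintype]
  simp_rw [PMF.uniformOfFintype_apply]
  rw [← Finset.sum_filter, Finset.sum_const, nsmul_eq_mul]
  have hcard : (Finset.univ.filter fun x : (Fin n → ZMod q) × ZMod q => x.2 = x.1 ⬝ᵥ c).card
      = q ^ n := by
    have himg : (Finset.univ.filter fun x : (Fin n → ZMod q) × ZMod q => x.2 = x.1 ⬝ᵥ c)
        = Finset.univ.image fun a : Fin n → ZMod q => (a, a ⬝ᵥ c) := by
      ext x
      simp only [Finset.mem_filter, Finset.mem_univ, true_and, Finset.mem_image]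
      constructor
      · intro hx
        exact ⟨x.1, Prod.ext rfl hx.symm⟩
      · rintro ⟨a, rfl⟩
        rfl
    rw [himg, Finset.card_image_of_injective _ fun a b h => (Prod.ext_iff.1 h).1]
    simp [ZMod.card]
  rw [hcard, Fintype.card_prod, Fintype.card_pi, Finset.prod_const, ZMod.card, Finset.card_univ,
    Fintype.card_fin]
  have hq : (q : ℝ≥0∞) ≠ 0 := by exact_mod_cast NeZero.ne q
  push_cast
  rw [ENNReal.mul_inv (Or.inr (ENNReal.natCast_ne_top q)) (Or.inl (ENNReal.pow_ne_top
    (ENNReal.natCast_ne_top q))), ← mul_assoc,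
    ENNReal.mul_inv_cancel (pow_ne_zero _ hq) (ENNReal.pow_ne_top (ENNReal.natCast_ne_top q)),
    one_mul]

/-- On an LWE fresh sample with secret `s`, the test against the guess `s'` accepts with
probability `E_a χ(⟨a, s' - s⟩)` (`a` uniform). [Regev 2009, §2 (the law `A_{s,χ}`)] [folklore] -/
theorem lweSample_map_residualTest_apply (χ : PMF (ZMod q)) (s s' : Fin n → ZMod q) :
    ((lweSample χ s).map fun x => decide (x.2 = x.1 ⬝ᵥ s')) true =
      ∑' a, PMF.uniformOfFintype (Fin n → ZMod q) a * χ (a ⬝ᵥ (s' - s)) := by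
  classical
  rw [lweSample, PMF.map_bind, PMF.bind_apply]
  refine tsum_congr fun a => ?_
  congr 1
  rw [PMF.map_comp]
  have : ((fun x : (Fin n → ZMod q) × ZMod q => decide (x.2 = x.1 ⬝ᵥ s')) ∘ fun e => (a, a ⬝ᵥ s + e))
      = fun e => decide (e = a ⬝ᵥ (s' - s)) := by
    funext e
    simp only [Function.comp_apply, dotProduct_sub]
    congr 1
    apply propext
    constructor <;> intro h
    · rw [← h]; ring
    · rw [h]; ring
  rw [this, map_decide_apply_true, tsum_eq_single (a ⬝ᵥ (s' - s)) (fun e he => if_neg he), if_pos rfl]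

/-- For `c = 0` the fresh-sample acceptance probability is `χ(0)`. [folklore] -/
theorem tsum_uniform_mul_apply_dotProduct_zero (χ : PMF (ZMod q)) :
    ∑' a, PMF.uniformOfFintype (Fin n → ZMod q) a * χ (a ⬝ᵥ (0 : Fin n → ZMod q)) = χ 0 := by
  simp_rw [dotProduct_zero]
  rw [ENNReal.tsum_mul_right, PMF.tsum_coe, one_mul]

/-- **Wrong guesses never help below the baseline.** For every `c`, the map `a ↦ ⟨a, c⟩` is a
homomorphism of `ℤ_qⁿ` onto a subgroup `H ≤ ℤ_q` and pushes the uniform law forward to the uniform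
law on `H`, so `E_a χ(⟨a, c⟩) = χ(H)/|H| ≥ 1/q` under the SUBGROUP BOUND on the noise law `χ`:
every subgroup of `ℤ_q` carries at least its uniform share, `χ(H) ≥ |H|/q` (hypothesis `hχ`, stated
for any finite set with the same elements as `H`; for Regev's `Ψ̄_α` it is the theorem
`discretizedGaussian_sum_addSubgroup_ge` of `DiscretizedGaussianMass.lean`). [folklore] -/
theorem inv_le_tsum_uniform_mul_apply_dotProduct (χ : PMF (ZMod q))
    (hχ : ∀ (H : AddSubgroup (ZMod q)) (T : Finset (ZMod q)), (∀ x, x ∈ T ↔ x ∈ H) →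
      (T.card : ℝ≥0∞) / q ≤ ∑ x ∈ T, χ x)
    (c : Fin n → ZMod q) :
    (q : ℝ≥0∞)⁻¹ ≤ ∑' a, PMF.uniformOfFintype (Fin n → ZMod q) a * χ (a ⬝ᵥ c) := by
  classical
  rw [tsum_fintype]
  simp_rw [PMF.uniformOfFintype_apply]
  rw [← Finset.mul_sum]
  -- the homomorphism `a ↦ ⟨a, c⟩`
  let f : (Fin n → ZMod q) →+ ZMod q :=
    { toFun := fun a => a ⬝ᵥ c
      map_zero' := zero_dotProduct c
      map_add' := fun a b => add_dotProduct a b c }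
  have hf : ∀ a, a ⬝ᵥ c = f a := fun a => rfl
  simp_rw [hf]
  set I : Finset (ZMod q) := Finset.univ.image f with hI
  set K : ℕ := (Finset.univ.filter fun a : Fin n → ZMod q => f a = 0).card with hK
  -- all fibres have `K` elements
  have hfib : ∀ b ∈ I, (Finset.univ.filter fun a : Fin n → ZMod q => f a = b).card = K := by
    intro b hb
    obtain ⟨a₀, -, rfl⟩ := Finset.mem_image.1 hb
    have himg : (Finset.univ.filter fun a : Fin n → ZMod q => f a = f a₀).image (fun a => a - a₀)
        = Finset.univ.filter fun a : Fin n → ZMod q => f a = 0 := by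
      ext x
      simp only [Finset.mem_image, Finset.mem_filter, Finset.mem_univ, true_and]
      constructor
      · rintro ⟨a, ha, rfl⟩
        rw [map_sub, ha, sub_self]
      · intro hx
        exact ⟨x + a₀, by rw [map_add, hx, zero_add], by simp⟩
    rw [hK, ← himg, Finset.card_image_of_injective _ (sub_left_injective)]
  have hsum : ∑ a, χ (f a) = K * ∑ b ∈ I, χ b := by
    rw [Finset.sum_comp (χ : ZMod q → ℝ≥0∞) f, Finset.mul_sum]
    refine Finset.sum_congr rfl fun b hb => ?_
    rw [hfib b hb, nsmul_eq_mul]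
  have hcardN : Fintype.card (Fin n → ZMod q) = I.card * K := by
    rw [← Finset.card_univ, Finset.card_eq_sum_card_image f Finset.univ]
    rw [Finset.sum_congr rfl hfib, Finset.sum_const, smul_eq_mul]
  have hI0 : I.card ≠ 0 := by
    rw [Finset.card_ne_zero]
    exact ⟨f 0, Finset.mem_image.2 ⟨0, Finset.mem_univ _, rfl⟩⟩
  have hK0 : K ≠ 0 := by
    rw [hK, Finset.card_ne_zero]
    exact ⟨0, by simp⟩
  -- the subgroup bound for `H = range f`
  have hH : (I.card : ℝ≥0∞) / q ≤ ∑ b ∈ I, χ b := by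
    refine hχ f.range I fun x => ?_
    rw [hI, Finset.mem_image, AddMonoidHom.mem_range]
    simp
  rw [hsum, hcardN, Nat.cast_mul, ENNReal.mul_inv (Or.inl (by exact_mod_cast hI0))
    (Or.inl (ENNReal.natCast_ne_top _)), mul_assoc, ← mul_assoc ((K : ℝ≥0∞))⁻¹,
    ENNReal.inv_mul_cancel (by exact_mod_cast hK0) (ENNReal.natCast_ne_top _), one_mul]
  calc (q : ℝ≥0∞)⁻¹ = ((I.card : ℝ≥0∞))⁻¹ * ((I.card : ℝ≥0∞) / q) := by
        rw [ENNReal.div_eq_inv_mul, mul_left_comm,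
          ENNReal.inv_mul_cancel (by exact_mod_cast hI0) (ENNReal.natCast_ne_top _), mul_one]
    _ ≤ _ := mul_le_mul' le_rfl hH

end Fresh

/-! ### Success and failure masses of the solver -/

section Success

variable [NeZero q]

/-- The success mass of the deterministic solver `F` on `m` LWE samples with a uniform secret:
`Pr_{s, t}[F t = s]`, written as an iterated sum. [Regev 2009, §4] [folklore] -/
def succMass (χ : PMF (ZMod q)) (m : ℕ)
    (F : (Fin m → (Fin n → ZMod q) × ZMod q) → (Fin n → ZMod q)) : ℝ≥0∞ :=
  ∑' s, PMF.uniformOfFintype (Fin n → ZMod q) s *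
    ∑' t, lweSamples χ s m t * (if F t = s then 1 else 0)

/-- The failure mass `Pr_{s, t}[F t ≠ s]`. [folklore] -/
def failMass (χ : PMF (ZMod q)) (m : ℕ)
    (F : (Fin m → (Fin n → ZMod q) × ZMod q) → (Fin n → ZMod q)) : ℝ≥0∞ :=
  ∑' s, PMF.uniformOfFintype (Fin n → ZMod q) s *
    ∑' t, lweSamples χ s m t * (if F t = s then 0 else 1)

/-- The success mass is the search success probability of the Dirac solver `pure ∘ F`
(`searchSuccessProb`). [Regev 2009, §4] [folklore] -/
theorem searchSuccessProb_pure_eq (χ : PMF (ZMod q)) (m : ℕ)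
    (F : (Fin m → (Fin n → ZMod q) × ZMod q) → (Fin n → ZMod q)) :
    searchSuccessProb χ m (fun S => PMF.pure (F S)) = succMass χ m F := by
  classical
  rw [searchSuccessProb, succMass, tsum_fintype]
  refine Finset.sum_congr rfl fun s _ => ?_
  congr 1
  rw [searchSuccessProbOf, PMF.bind_apply]
  refine tsum_congr fun t => ?_
  congr 1
  rw [PMF.pure_apply]
  by_cases h : F t = s
  · rw [if_pos h.symm, if_pos h]
  · rw [if_neg (Ne.symm h), if_neg h]

/-- Success and failure masses add up to `1`. [folklore] -/
theorem succMass_add_failMass (χ : PMF (ZMod q)) (m : ℕ)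
    (F : (Fin m → (Fin n → ZMod q) × ZMod q) → (Fin n → ZMod q)) :
    succMass χ m F + failMass χ m F = 1 := by
  rw [succMass, failMass, ← ENNReal.tsum_add]
  simp_rw [← mul_add, ← ENNReal.tsum_add, ← mul_add]
  have h : ∀ (s : Fin n → ZMod q) (t : Fin m → (Fin n → ZMod q) × ZMod q),
      ((if F t = s then (1 : ℝ≥0∞) else 0) + if F t = s then 0 else 1) = 1 := by
    intro s t; by_cases h : F t = s <;> simp [h]
  simp_rw [h, mul_one, PMF.tsum_coe, mul_one, PMF.tsum_coe]

/-- The masses are finite. [folklore] -/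
theorem succMass_ne_top (χ : PMF (ZMod q)) (m : ℕ)
    (F : (Fin m → (Fin n → ZMod q) × ZMod q) → (Fin n → ZMod q)) : succMass χ m F ≠ ∞ :=
  ne_top_of_le_ne_top ENNReal.one_ne_top (le_of_le_of_eq le_self_add (succMass_add_failMass χ m F))

/-- The masses are finite. [folklore] -/
theorem failMass_ne_top (χ : PMF (ZMod q)) (m : ℕ)
    (F : (Fin m → (Fin n → ZMod q) × ZMod q) → (Fin n → ZMod q)) : failMass χ m F ≠ ∞ :=
  ne_top_of_le_ne_top ENNReal.one_ne_top (le_of_le_of_eq le_add_self (succMass_add_failMass χ m F))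

end Success

/-! ### Acceptance probabilities and the advantage -/

section Advantage

variable [NeZero q]

/-- **Uniform samples are accepted with probability exactly `1/q`.** [Regev 2009, §1] [folklore] -/
theorem acceptProb_zeroResidual_uniformSamples (m : ℕ)
    (F : (Fin m → (Fin n → ZMod q) × ZMod q) → (Fin n → ZMod q)) :
    acceptProb (zeroResidualDistinguisher F) (uniformSamples (Fin n) (ZMod q) (m + 1)) = (q : ℝ≥0∞)⁻¹ := by
  rw [acceptProb_zeroResidualDistinguisher, uniformSamples_eq_iidPMF_holds, iidPMF_succ,
    ← uniformSamples_eq_iidPMF_holds, map_zeroResidualTest_bind_cons_apply]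
  simp_rw [uniform_map_residualTest_apply, ENNReal.tsum_mul_right, PMF.tsum_coe, one_mul]

/-- **LWE samples: `Pr[accept] ≥ (1/q)·Pr[F fails] + χ(0)·Pr[F solves]`** under the subgroup bound
on `χ`. [Regev 2009, §1; folklore] [folklore] -/
theorem le_acceptProb_zeroResidual_lwe (χ : PMF (ZMod q))
    (hχ : ∀ (H : AddSubgroup (ZMod q)) (T : Finset (ZMod q)), (∀ x, x ∈ T ↔ x ∈ H) →
      (T.card : ℝ≥0∞) / q ≤ ∑ x ∈ T, χ x)
    (m : ℕ) (F : (Fin m → (Fin n → ZMod q) × ZMod q) → (Fin n → ZMod q)) :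
    (q : ℝ≥0∞)⁻¹ * failMass χ m F + χ 0 * succMass χ m F ≤
      acceptProb (zeroResidualDistinguisher F) (lweSamplesUniformSecret χ (m + 1)) := by
  classical
  rw [acceptProb_zeroResidualDistinguisher, lweSamplesUniformSecret, PMF.map_bind, PMF.bind_apply]
  rw [failMass, succMass, ← ENNReal.tsum_mul_left, ← ENNReal.tsum_mul_left, ← ENNReal.tsum_add]
  refine ENNReal.tsum_le_tsum fun s => ?_
  rw [← mul_assoc, ← mul_assoc, mul_comm ((q : ℝ≥0∞))⁻¹, mul_comm (χ 0), mul_assoc, mul_assoc,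
    ← mul_add]
  refine mul_le_mul' le_rfl ?_
  have hsplit : lweSamples χ s (m + 1) =
      (lweSample χ s).bind fun x => (lweSamples χ s m).map (Fin.cons x) := rfl
  rw [hsplit, map_zeroResidualTest_bind_cons_apply, ← ENNReal.tsum_mul_left,
    ← ENNReal.tsum_mul_left, ← ENNReal.tsum_add]
  refine ENNReal.tsum_le_tsum fun t => ?_
  rw [← mul_assoc, ← mul_assoc, mul_comm ((q : ℝ≥0∞))⁻¹, mul_comm (χ 0), mul_assoc,
    mul_assoc, ← mul_add]
  refine mul_le_mul' le_rfl ?_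
  rw [lweSample_map_residualTest_apply]
  by_cases h : F t = s
  · rw [if_pos h, if_pos h, mul_zero, zero_add, mul_one, h, sub_self,
      tsum_uniform_mul_apply_dotProduct_zero]
  · rw [if_neg h, if_neg h, mul_one, mul_zero, add_zero]
    exact inv_le_tsum_uniform_mul_apply_dotProduct χ hχ _

/-- **The advantage of the zero-residual distinguisher is at least `(χ(0) - 1/q) · Pr[F solves]`**
(under the subgroup bound on `χ`). [Regev 2009, §1 (search ⇒ decision); Peikert 2016, §4.2.2]
[cite: RegevLWE2009, §1 p. 4] -/
theorem distinguishingAdvantage_zeroResidual_ge (χ : PMF (ZMod q))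
    (hχ : ∀ (H : AddSubgroup (ZMod q)) (T : Finset (ZMod q)), (∀ x, x ∈ T ↔ x ∈ H) →
      (T.card : ℝ≥0∞) / q ≤ ∑ x ∈ T, χ x)
    (m : ℕ) (F : (Fin m → (Fin n → ZMod q) × ZMod q) → (Fin n → ZMod q)) :
    ((χ 0).toReal - 1 / q) * (searchSuccessProb χ m fun S => PMF.pure (F S)).toReal ≤
      distinguishingAdvantage χ (m + 1) (zeroResidualDistinguisher F) := by
  rw [searchSuccessProb_pure_eq, distinguishingAdvantage, acceptProb_zeroResidual_uniformSamples]
  have hlwe := le_acceptProb_zeroResidual_lwe χ hχ m F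
  have hfin : acceptProb (zeroResidualDistinguisher F) (lweSamplesUniformSecret χ (m + 1)) ≠ ∞ :=
    ne_top_of_le_ne_top ENNReal.one_ne_top (acceptProb_le_one _ _)
  have h1 := ENNReal.toReal_mono hfin hlwe
  have hq : (q : ℝ≥0∞)⁻¹ ≠ ∞ := ENNReal.inv_ne_top.2 (by exact_mod_cast NeZero.ne q)
  rw [ENNReal.toReal_add (ENNReal.mul_ne_top hq (failMass_ne_top χ m F))
    (ENNReal.mul_ne_top (PMF.apply_ne_top _ _) (succMass_ne_top χ m F)),
    ENNReal.toReal_mul, ENNReal.toReal_mul] at h1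
  have h2 := congrArg ENNReal.toReal (succMass_add_failMass χ m F)
  rw [ENNReal.toReal_add (succMass_ne_top χ m F) (failMass_ne_top χ m F), ENNReal.toReal_one] at h2
  have hinv : ((q : ℝ≥0∞)⁻¹).toReal = 1 / q := by
    rw [ENNReal.toReal_inv, ENNReal.toReal_natCast, one_div]
  rw [hinv] at h1 ⊢
  refine le_trans ?_ (le_abs_self _)
  have h3 : 1 / (q : ℝ) * (succMass χ m F).toReal + 1 / (q : ℝ) * (failMass χ m F).toReal = 1 / q := by
    rw [← mul_add, h2, mul_one]
  linarith [h1, h3]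

end Advantage

end LWE

end Literature.Computability.Cryptography

end
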